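import Literature.MathematicalPhysics.QuantumLattice.TorusSectorGibbsMixture
import HarnessLib

/-!
# Free energy versus Gibbs mean energy for two sector families of the `t–t'` torus, and the mean energies
# of a pair of torus limits linked by a partition-function ratio

Topic `Literature/MathematicalPhysics/QuantumLattice`; complement of `TorusSectorGibbsMixture.lean` (canonical
eigen-mixtures of a Hermitian matrix compressed to a coordinate sector; the energy–entropy cap
`⟨E⟩ ≤ E₀ + log(dim)/β`). The two-sector (charged) energy–entropy balance rows of the thermal object of record
come with a COMPANION torus limit `ω'` (canonical states of a second sector family) and the limit `r` of the
ratio `Z'/Z` of canonical partition functions; this file supplies the free-energy bookkeeping that turns the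
convergence of that ratio into ENERGY rows for `ω'`:

* §1 finite families of energies `E : κ → ℝ` with canonical weights `w_a = e^{−βE_a}/Z`: `log w_a = −βE_a − log Z`;
  `F ≤ ⟨E⟩` (`−log Z ≤ β Σ w_a E_a`, `neg_log_partitionSum_le_mul_gibbsMean`); `⟨E⟩ ≤ F + log(#κ)/β`
  (`mul_gibbsMean_le_log_card_sub_log_partitionSum`, entropy `≤ log #κ`); `F ≤ E_a`
  (`neg_log_partitionSum_le_mul_level`); hence for TWO families
  `β⟨E'⟩ ≤ log #κ' + β⟨E⟩ − log(Z'/Z)` (`mul_gibbsMean_le_of_partitionRatio`) and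
  `β⟨E'⟩ ≤ log #κ' + βE_c − log(Z'/Z)` (`mul_gibbsMean_le_level_of_partitionRatio`);
* §2 `IsTorusLimitOfMixture.meanEnergy_le_meanEnergy_add_of_partitionRatio` (abstract two-sector form, any
  presentations `(m, p, ψ, e)`): for torus limits `ω`, `ω'` ALONG THE SAME `Ls → ∞` of the canonical
  eigen-mixtures of sector families `P_L`, `P'_L` of `hubbardTorusTT' L t t' U` (both eventually nonempty), with
  `Z_{P'}/Z_P → r > 0` and `log #P'_L ≤ s·L²` eventually: `e_Φ(ω') ≤ e_Φ(ω) + s/β` (`β > 0`; no sign condition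
  on `t, t', U`) — `log(Z'/Z)/L² → 0` because the ratio converges to a POSITIVE number
  (`sum_presentation_mul_re_expect_eq_gibbsMean` identifies the weighted energies of a presentation with the
  Gibbs mean of the sector eigenvalues).

Everything is PROVED; no definition, no named fact.

## Mathlib / tree search

REUSED: `canonicalWeight`, `sum_canonicalWeight`, `sectorEigenvalue`, `re_rayleigh_sectorEigenvector`
(`TorusSectorGibbsMixture`), `Matrix.neg_sum_mul_log_le` (`DuhamelTwoPoint`),
`IsTorusLimitOfMixture.tendsto_meanEnergy_hubbardTTPrime` (`TorusLimitOfMixtures`), Mathlib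
`Real.continuousAt_log`, `Filter.Tendsto.div_atTop`, `Filter.Tendsto.const_mul_atTop`, `le_of_tendsto_of_tendsto`.
`lean search 'gibbsMean|partitionRatio'`: nothing in this namespace (2026-08-27).

## References

* R. B. Israel, *Convexity in the Theory of Lattice Gases* (1979), Lemma II.3.1, §I.3 eq. (26).
  [cite: Israel1979, Lemma II.3.1]
* O. Bratteli, D. W. Robinson, *OAQSM 2* (1997), §5.4.2. [cite: BratteliRobinsonII1997, §5.4.2]
* D. Ruelle, *Statistical Mechanics: Rigorous Results* (1969), §3.4. [cite: Ruelle1969, §3.4]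
-/

noncomputable section

namespace Literature.MathematicalPhysics.QuantumLattice

open Matrix Finset HubbardWave0 Literature.Probability.LatticeModels ThermodynamicLimit
open _root_.Filter
open scoped _root_.Topology ComplexOrder BigOperators

/-! ### §1 Finite families of energies: free energy versus Gibbs mean energy -/

section FreeEnergy

variable {κ : Type*} [Fintype κ]

/-- `log` of a canonical weight: `log w_a = −βE_a − log Z`. [cite: Israel1979, Lemma II.3.1] -/
theorem log_canonicalWeight [Nonempty κ] (β : ℝ) (E : κ → ℝ) (a : κ) :
    Real.log (canonicalWeight β E a) = -(β * E a) - Real.log (∑ b, Real.exp (-(β * E b))) := by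
  have hZ : 0 < ∑ b, Real.exp (-(β * E b)) := Finset.sum_pos (fun _ _ => Real.exp_pos _) Finset.univ_nonempty
  unfold canonicalWeight
  rw [Real.log_mul (inv_pos.2 hZ).ne' (Real.exp_pos _).ne', Real.log_inv, Real.log_exp]
  ring

/-- **`F ≤ ⟨E⟩`**: `−log Z ≤ β · Σ_a w_a E_a` for the canonical weights `w_a = e^{−βE_a}/Z` (the entropy
`−Σ w log w` is nonnegative). [cite: Israel1979, Lemma II.3.1] -/
theorem neg_log_partitionSum_le_mul_gibbsMean [Nonempty κ] (β : ℝ) (E : κ → ℝ) :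
    -Real.log (∑ b, Real.exp (-(β * E b))) ≤ β * ∑ a, canonicalWeight β E a * E a := by
  have hw0 : ∀ a, 0 < canonicalWeight β E a := fun a =>
    mul_pos (inv_pos.2 (Finset.sum_pos (fun _ _ => Real.exp_pos _) Finset.univ_nonempty)) (Real.exp_pos _)
  have hw1 : ∑ a, canonicalWeight β E a = 1 := sum_canonicalWeight β E
  have hle1 : ∀ a, canonicalWeight β E a ≤ 1 := fun a => by
    rw [← hw1]
    exact Finset.single_le_sum (fun b _ => (hw0 b).le) (Finset.mem_univ a)
  -- `Σ w log w ≤ 0`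
  have hent : ∑ a, canonicalWeight β E a * Real.log (canonicalWeight β E a) ≤ 0 :=
    Finset.sum_nonpos fun a _ => mul_nonpos_of_nonneg_of_nonpos (hw0 a).le (Real.log_nonpos (hw0 a).le (hle1 a))
  simp_rw [log_canonicalWeight, mul_sub, mul_neg, Finset.sum_sub_distrib, Finset.sum_neg_distrib,
    ← Finset.sum_mul, hw1, one_mul] at hent
  have : ∑ a, canonicalWeight β E a * (β * E a) = β * ∑ a, canonicalWeight β E a * E a := by
    rw [Finset.mul_sum]
    refine Finset.sum_congr rfl fun a _ => ?_
    ring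
  linarith

/-- **`⟨E⟩ ≤ F + log(dim)/β`**: `β · Σ_a w_a E_a ≤ log #κ − log Z` (the entropy is at most `log #κ`).
[cite: Israel1979, Lemma II.3.1] -/
theorem mul_gibbsMean_le_log_card_sub_log_partitionSum [Nonempty κ] (β : ℝ) (E : κ → ℝ) :
    β * ∑ a, canonicalWeight β E a * E a ≤
      Real.log (Fintype.card κ) - Real.log (∑ b, Real.exp (-(β * E b))) := by
  classical
  have hw0 : ∀ a, 0 < canonicalWeight β E a := fun a =>
    mul_pos (inv_pos.2 (Finset.sum_pos (fun _ _ => Real.exp_pos _) Finset.univ_nonempty)) (Real.exp_pos _)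
  have hw1 : ∑ a, canonicalWeight β E a = 1 := sum_canonicalWeight β E
  have hent := Matrix.neg_sum_mul_log_le hw0 hw1
  simp_rw [log_canonicalWeight, mul_sub, mul_neg, Finset.sum_sub_distrib, Finset.sum_neg_distrib,
    ← Finset.sum_mul, hw1, one_mul] at hent
  have : ∑ a, canonicalWeight β E a * (β * E a) = β * ∑ a, canonicalWeight β E a * E a := by
    rw [Finset.mul_sum]
    refine Finset.sum_congr rfl fun a _ => ?_
    ring
  linarith

/-- **`F ≤ E_a` for every level**: `−log Z ≤ β E_a`. [cite: Israel1979, Lemma II.3.1] -/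
theorem neg_log_partitionSum_le_mul_level (β : ℝ) (E : κ → ℝ) (a : κ) :
    -Real.log (∑ b, Real.exp (-(β * E b))) ≤ β * E a := by
  have h : Real.exp (-(β * E a)) ≤ ∑ b, Real.exp (-(β * E b)) :=
    Finset.single_le_sum (f := fun b => Real.exp (-(β * E b))) (fun _ _ => (Real.exp_pos _).le) (Finset.mem_univ a)
  have := Real.log_le_log (Real.exp_pos _) h
  rw [Real.log_exp] at this
  linarith

/-- **Two families: the Gibbs mean of the second is controlled by that of the first, the dimension of
the second and the ratio of partition functions**:
`β⟨E'⟩ ≤ log #κ' + β⟨E⟩ − log(Z'/Z)`. [cite: Israel1979, Lemma II.3.1] [cite: BratteliRobinsonII1997, §5.4.2] -/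
theorem mul_gibbsMean_le_of_partitionRatio {κ' : Type*} [Fintype κ'] [Nonempty κ] [Nonempty κ'] (β : ℝ)
    (E : κ → ℝ) (E' : κ' → ℝ) :
    β * ∑ d, canonicalWeight β E' d * E' d ≤
      Real.log (Fintype.card κ') + β * ∑ c, canonicalWeight β E c * E c -
        Real.log ((∑ d, Real.exp (-(β * E' d))) / ∑ c, Real.exp (-(β * E c))) := by
  have hZ : 0 < ∑ c, Real.exp (-(β * E c)) := Finset.sum_pos (fun _ _ => Real.exp_pos _) Finset.univ_nonempty
  have hZ' : 0 < ∑ d, Real.exp (-(β * E' d)) := Finset.sum_pos (fun _ _ => Real.exp_pos _) Finset.univ_nonempty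
  rw [Real.log_div hZ'.ne' hZ.ne']
  linarith [mul_gibbsMean_le_log_card_sub_log_partitionSum β E', neg_log_partitionSum_le_mul_gibbsMean β E]

/-- **… and by any single level of the first family**: `β⟨E'⟩ ≤ log #κ' + βE_c − log(Z'/Z)`.
[cite: Israel1979, Lemma II.3.1] -/
theorem mul_gibbsMean_le_level_of_partitionRatio {κ' : Type*} [Fintype κ'] [Nonempty κ] [Nonempty κ']
    (β : ℝ) (E : κ → ℝ) (E' : κ' → ℝ) (c : κ) :
    β * ∑ d, canonicalWeight β E' d * E' d ≤
      Real.log (Fintype.card κ') + β * E c -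
        Real.log ((∑ d, Real.exp (-(β * E' d))) / ∑ c, Real.exp (-(β * E c))) := by
  have hZ : 0 < ∑ c, Real.exp (-(β * E c)) := Finset.sum_pos (fun _ _ => Real.exp_pos _) Finset.univ_nonempty
  have hZ' : 0 < ∑ d, Real.exp (-(β * E' d)) := Finset.sum_pos (fun _ _ => Real.exp_pos _) Finset.univ_nonempty
  rw [Real.log_div hZ'.ne' hZ.ne']
  linarith [mul_gibbsMean_le_log_card_sub_log_partitionSum β E', neg_log_partitionSum_le_mul_level β E c]

end FreeEnergy

/-! ### §2 Two sector families in the thermodynamic limit: the mean energies of a pair of torus limits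
differ by at most the entropy density over `β` -/

section Limit

variable (t t' U β : ℝ)

/-- The weighted energies of a canonical presentation are the Gibbs mean of the sector eigenvalues:
`Σ_i p_i Re⟨ψ_i, H_L ψ_i⟩ = Σ_c w_c E_c`. [cite: Israel1979, §I.3 eq. (26)] -/
theorem sum_presentation_mul_re_expect_eq_gibbsMean {L : ℕ} {P : Finset (Orb (FermionTorus 2 L)) → Prop}
    [DecidablePred P] (hP : ∀ s s', ¬ P s → P s' → hubbardTorusTT' L t t' U s s' = 0)
    {m : ℕ} {p : Fin m → ℝ} {ψ : Fin m → Fock (Orb (FermionTorus 2 L))} (e : Fin m ≃ Subtype P)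
    (hp : ∀ i, p i = canonicalWeight β (sectorEigenvalue P (hubbardTorusTT' L t t' U)
      (hubbardTorusTT'_isHermitian L t t' U)) (e i))
    (hψ : ∀ i, ψ i = sectorEigenvector P (hubbardTorusTT' L t t' U)
      (hubbardTorusTT'_isHermitian L t t' U) (e i)) :
    ∑ i, p i * (QuantumLattice.expect (hubbardTorusTT' L t t' U) (ψ i)).re =
      ∑ c, canonicalWeight β (sectorEigenvalue P (hubbardTorusTT' L t t' U)
          (hubbardTorusTT'_isHermitian L t t' U)) c *
        sectorEigenvalue P (hubbardTorusTT' L t t' U) (hubbardTorusTT'_isHermitian L t t' U) c := by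
  simp_rw [hp, hψ, QuantumLattice.expect,
    re_rayleigh_sectorEigenvector P (hubbardTorusTT'_isHermitian L t t' U) hP]
  exact Equiv.sum_comp e (fun c => canonicalWeight β (sectorEigenvalue P (hubbardTorusTT' L t t' U)
    (hubbardTorusTT'_isHermitian L t t' U)) c *
      sectorEigenvalue P (hubbardTorusTT' L t t' U) (hubbardTorusTT'_isHermitian L t t' U) c)

/-- **Mean energies of a pair of torus limits linked by a partition-function ratio.** Let `P_L`, `P'_L`
be sector families of the `t–t'` torus (no matrix elements of `H_L` leave them), `ω`, `ω'` torus limits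
ALONG THE SAME `Ls → ∞` of their canonical eigen-mixtures (any presentations), both families eventually
nonempty, `Z_{P'}(Ls j)/Z_P(Ls j) → r > 0`, `β > 0`, and `log #P'_{Ls j} ≤ s·(Ls j)²` eventually. Then
`e_Φ(ω') ≤ e_Φ(ω) + s/β` (`Φ = Φ(t,t',U)`): at finite volume `β⟨E'⟩ ≤ log #P' + β⟨E⟩ − log(Z'/Z)`
(`F' = F − β⁻¹ log(Z'/Z)`, `F ≤ ⟨E⟩`, `⟨E'⟩ ≤ F' + β⁻¹ log #P'`), divide by `(Ls j)²`, and
`log(Z'/Z)/(Ls j)² → 0` because the ratio CONVERGES to a positive number. No sign or size condition on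
`t, t', U`. [cite: Israel1979, Lemma II.3.1] [cite: BratteliRobinsonII1997, §5.4.2] [cite: Ruelle1969, §3.4] -/
theorem InfVolFermionState.IsTorusLimitOfMixture.meanEnergy_le_meanEnergy_add_of_partitionRatio
    (hβ : 0 < β) (P P' : ∀ L : ℕ, Finset (Orb (FermionTorus 2 L)) → Prop)
    [hdP : ∀ L, DecidablePred (P L)] [hdP' : ∀ L, DecidablePred (P' L)]
    (hP : ∀ L s s', ¬ P L s → P L s' → hubbardTorusTT' L t t' U s s' = 0)
    (hP' : ∀ L s s', ¬ P' L s → P' L s' → hubbardTorusTT' L t t' U s s' = 0)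
    {m m' : ℕ → ℕ} {p : ∀ L, Fin (m L) → ℝ} {ψ : ∀ L, Fin (m L) → Fock (Orb (FermionTorus 2 L))}
    {p' : ∀ L, Fin (m' L) → ℝ} {ψ' : ∀ L, Fin (m' L) → Fock (Orb (FermionTorus 2 L))}
    (e : ∀ L, Fin (m L) ≃ Subtype (P L)) (e' : ∀ L, Fin (m' L) ≃ Subtype (P' L))
    (hp : ∀ L i, p L i = canonicalWeight β (sectorEigenvalue (P L) (hubbardTorusTT' L t t' U)
      (hubbardTorusTT'_isHermitian L t t' U)) (e L i))
    (hψ : ∀ L i, ψ L i = sectorEigenvector (P L) (hubbardTorusTT' L t t' U)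
      (hubbardTorusTT'_isHermitian L t t' U) (e L i))
    (hp' : ∀ L i, p' L i = canonicalWeight β (sectorEigenvalue (P' L) (hubbardTorusTT' L t t' U)
      (hubbardTorusTT'_isHermitian L t t' U)) (e' L i))
    (hψ' : ∀ L i, ψ' L i = sectorEigenvector (P' L) (hubbardTorusTT' L t t' U)
      (hubbardTorusTT'_isHermitian L t t' U) (e' L i))
    {Ls : ℕ → ℕ} (hLs : Tendsto Ls atTop atTop) {ω ω' : InfVolFermionState 2}
    (hω : ω.IsTorusLimitOfMixture m p ψ Ls) (hω' : ω'.IsTorusLimitOfMixture m' p' ψ' Ls)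
    (hne : ∀ᶠ j in atTop, Nonempty (Subtype (P (Ls j))))
    (hne' : ∀ᶠ j in atTop, Nonempty (Subtype (P' (Ls j))))
    {r : ℝ} (hr0 : 0 < r) (hr : Tendsto (fun j =>
      (∑ d, Real.exp (-(β * sectorEigenvalue (P' (Ls j)) (hubbardTorusTT' (Ls j) t t' U)
          (hubbardTorusTT'_isHermitian (Ls j) t t' U) d))) /
        ∑ c, Real.exp (-(β * sectorEigenvalue (P (Ls j)) (hubbardTorusTT' (Ls j) t t' U)
          (hubbardTorusTT'_isHermitian (Ls j) t t' U) c))) atTop (𝓝 r))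
    {s : ℝ} (hS : ∀ᶠ j in atTop, Real.log (Fintype.card (Subtype (P' (Ls j)))) ≤ s * (Ls j : ℝ) ^ 2) :
    ω'.meanEnergy (hubbardTTPrimeFermionInteraction t t' U) 1 ≤
      ω.meanEnergy (hubbardTTPrimeFermionInteraction t t' U) 1 + s / β := by
  set R : ℕ → ℝ := fun j =>
    (∑ d, Real.exp (-(β * sectorEigenvalue (P' (Ls j)) (hubbardTorusTT' (Ls j) t t' U)
        (hubbardTorusTT'_isHermitian (Ls j) t t' U) d))) /
      ∑ c, Real.exp (-(β * sectorEigenvalue (P (Ls j)) (hubbardTorusTT' (Ls j) t t' U)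
        (hubbardTorusTT'_isHermitian (Ls j) t t' U) c)) with hR
  have h1 := hω.tendsto_meanEnergy_hubbardTTPrime t t' U hLs
  have h1' := hω'.tendsto_meanEnergy_hubbardTTPrime t t' U hLs
  -- `log(Z'/Z)/(β L²) → 0`
  have hlog : Tendsto (fun j => Real.log (R j) / (β * (Ls j : ℝ) ^ 2)) atTop (𝓝 0) := by
    have hnum : Tendsto (fun j => Real.log (R j)) atTop (𝓝 (Real.log r)) :=
      (Real.continuousAt_log hr0.ne').tendsto.comp hr
    have hden : Tendsto (fun j => β * (Ls j : ℝ) ^ 2) atTop atTop :=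
      ((tendsto_pow_atTop two_ne_zero).comp (tendsto_natCast_atTop_atTop.comp hLs)).const_mul_atTop hβ
    exact hnum.div_atTop hden
  have h2 : Tendsto (fun j => ∑ i, p (Ls j) i *
        ((QuantumLattice.expect (hubbardTorusTT' (Ls j) t t' U) (ψ (Ls j) i)).re / (Ls j : ℝ) ^ 2) +
      s / β - Real.log (R j) / (β * (Ls j : ℝ) ^ 2)) atTop
      (𝓝 (ω.meanEnergy (hubbardTTPrimeFermionInteraction t t' U) 1 + s / β - 0)) :=
    (h1.add_const (s / β)).sub hlog
  rw [sub_zero] at h2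
  refine le_of_tendsto_of_tendsto h1' h2 ?_
  filter_upwards [hne, hne', hS, hLs.eventually_ge_atTop 1] with j hn hn' hSj hj
  haveI := hn
  haveI := hn'
  have hL2 : (0 : ℝ) < (Ls j : ℝ) ^ 2 := by
    have : (1 : ℝ) ≤ Ls j := by exact_mod_cast hj
    positivity
  have hβL : (0 : ℝ) < β * (Ls j : ℝ) ^ 2 := mul_pos hβ hL2
  -- finite volume: `β⟨E'⟩ ≤ log #P' + β⟨E⟩ − log(Z'/Z)`
  have key := mul_gibbsMean_le_of_partitionRatio β
    (sectorEigenvalue (P (Ls j)) (hubbardTorusTT' (Ls j) t t' U) (hubbardTorusTT'_isHermitian (Ls j) t t' U))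
    (sectorEigenvalue (P' (Ls j)) (hubbardTorusTT' (Ls j) t t' U) (hubbardTorusTT'_isHermitian (Ls j) t t' U))
  rw [← sum_presentation_mul_re_expect_eq_gibbsMean t t' U β (hP (Ls j)) (e (Ls j)) (hp (Ls j)) (hψ (Ls j)),
    ← sum_presentation_mul_re_expect_eq_gibbsMean t t' U β (hP' (Ls j)) (e' (Ls j)) (hp' (Ls j)) (hψ' (Ls j))]
    at key
  set A := ∑ i, p' (Ls j) i * (QuantumLattice.expect (hubbardTorusTT' (Ls j) t t' U) (ψ' (Ls j) i)).re with hA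
  set B := ∑ i, p (Ls j) i * (QuantumLattice.expect (hubbardTorusTT' (Ls j) t t' U) (ψ (Ls j) i)).re with hB
  have hsumA : ∑ i, p' (Ls j) i *
      ((QuantumLattice.expect (hubbardTorusTT' (Ls j) t t' U) (ψ' (Ls j) i)).re / (Ls j : ℝ) ^ 2) =
      A / (Ls j : ℝ) ^ 2 := by
    rw [hA, Finset.sum_div]
    refine Finset.sum_congr rfl fun i _ => ?_
    ring
  have hsumB : ∑ i, p (Ls j) i *
      ((QuantumLattice.expect (hubbardTorusTT' (Ls j) t t' U) (ψ (Ls j) i)).re / (Ls j : ℝ) ^ 2) =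
      B / (Ls j : ℝ) ^ 2 := by
    rw [hB, Finset.sum_div]
    refine Finset.sum_congr rfl fun i _ => ?_
    ring
  rw [hsumA, hsumB]
  have key' : β * A ≤ s * (Ls j : ℝ) ^ 2 + β * B - Real.log (R j) := by
    have := hSj
    rw [hR]
    linarith
  calc A / (Ls j : ℝ) ^ 2 = β * A / (β * (Ls j : ℝ) ^ 2) := by
        field_simp
    _ ≤ (s * (Ls j : ℝ) ^ 2 + β * B - Real.log (R j)) / (β * (Ls j : ℝ) ^ 2) :=
        div_le_div_of_nonneg_right key' hβL.le
    _ = B / (Ls j : ℝ) ^ 2 + s / β - Real.log (R j) / (β * (Ls j : ℝ) ^ 2) := by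
        field_simp
        ring

end Limit

end Literature.MathematicalPhysics.QuantumLattice

end
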